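import Literature.AlgebraicGeometry.Modules.CechUnitModulePairing
import Literature.Algebra.Homology.OrderedCechSystemFull
import Mathlib.Algebra.BigOperators.Fin
import HarnessLib

/-!
# The degree-`≤ 2` dictionary between the FULL algebraic Čech complex of `𝒪_X` and raw triple-indexed cochains
# (The Stacks Project, Tags 01FG, 01FP; Görtz–Wedhorn II, Def. 21.64 / 21.68)

Topic `AlgebraicGeometry/Modules`; namespace `Literature.AlgebraicGeometry.Modules`.  THEOREMS ONLY (no `def`, no instance, no
notation, no `sorry`).  Cell `hodgecm-mathlib` FLOOR 0, P1 sub-line F-11, grandchild `F11LiftWithLineBundle`, stub G2: the last mile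
between F0P1b-p02 (g2)'s F-J3b HEAD 2 `FJ3b.exists_sum_cup_add_d_of_surjective` (module FULL dialect) and the raw `hJ3` block of ★
`AbelianSchemes.TangentCocycleOfCechTwoCocycle` (F0P1b-p03 (g2)).

For a scheme `X`, a ring map `ρ : A → Γ(X, 𝒪_X)` and a linearly ordered family of opens `𝓤 = (U_i)_{i ∈ ι}`, write
`S := Modules.sectionsSystem 𝓤 (unitModule X) ρ` (`s ↦ Γ(𝒪_X, U_s)`).  A full `n`-cochain (★ `OrderedCech.Full.Cochain S n`) is a family
`c_α ∈ Γ(𝒪_X, U_{ {α} })` over ALL tuples `α : Fin (n+1) → ι`; a RAW `n`-cochain is a family over `n+1` indices with values in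
`Γ(X, U_j ∩ U_l (∩ U_m …))` — the currency of ★ `Deformation/PairLiftObstructionMove`, of the (I1) socket and of `Morphisms/CechModuleH2`.
The two differ by the identification `U_{ {j,l,m} } = U_j ∩ U_l ∩ U_m` (equal opens, different spellings), i.e. by restrictions along
`≤` in both directions.  §1 reads the full side out in raw letters — components of `S.map`, the cup product
`Full.cup (mulPairing 𝓤 ρ) 1 1 2 rfl x y` at `(j,l,m)` (`= x_{jl}| · y_{lm}|`, [StacksProject, Tag 01FP]), `d : Full 1 → Full 2` at
`(j,l,m)` (`= w_{lm}| − w_{jm}| + w_{jl}|`) and `d : Full 2 → Full 3` at a `3`-tuple `β` (alternating sum of the faces `c(β ∘ δ_k)|`,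
[StacksProject, Tag 01FG]); §2 `full_d_eq_zero_of_raw_cocycle`: a raw `2`-cocycle (identity of ★
`Deformation.pairObstructionCochain_cocycle`'s shape) read as a full `2`-cochain is a cocycle of ★ `OrderedCech.Full.complex S`; §3 a
full `1`-cocycle read in raw letters is a raw `1`-cocycle, and `d w = c − ∑ᵢ aᵢ ∪ bᵢ` read at `(j,l,m)` is the raw identity
`s_{jlm} = ∑ᵢ aᵢ_{jl}|·bᵢ_{lm}| + (h′_{jm}| − h′_{jl}| − h′_{lm}|)` with `h′ := −w`; §4 HEAD `exists_raw_sum_cup_of_full`: IF every full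
`2`-cocycle is `∑ᵢ aᵢ ∪ bᵢ + d w` with full `1`-cocycles `aᵢ bᵢ` (F-J3b HEAD 2, as a hypothesis), THEN every raw `2`-cocycle is
`∑ᵢ aᵢ ⌣ cᵢ + δ⁻h′` in the raw letters of ★ `AbelianSchemeOver.exists_tangentCocycle_of_sum_cup` (`σ a c ha hc h' hJ3`).
HC_CM is proved only modulo the 7 printed citations until rung 0 closes; this file is bookkeeping and asserts nothing about HC.

## References
* The Stacks Project, Tag 01FG (Čech complex, all tuples), Tag 01FP (cup product). [StacksProject]
* U. Görtz, T. Wedhorn, *Algebraic Geometry II* (2023), Def. 21.64 (p. 179), Def. 21.68 (p. 180). [GortzWedhorn2023]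
-/

noncomputable section

open CategoryTheory AlgebraicGeometry TopologicalSpace Opposite
open Literature.Algebra.Homology Literature.Algebra.Homology.OrderedCech

set_option backward.isDefEq.respectTransparency false -- `ModuleCat`-valued functors (as in ★ `OrderedCechSystemFull`)

universe u

namespace Literature.AlgebraicGeometry.Modules

variable {X : Scheme.{u}} {ι : Type} [LinearOrder ι] (U : ι → X.Opens) {A : Type u} [CommRing A] (ρ : A →+* Γ(X, ⊤))

/-! ## §0 Plumbing: inequalities of opens, tuples, `toRing` of sums -/

/-- `U_{ {α} } ≤ U_{α k}`. [cite: GortzWedhorn2023, Def. 21.64 (p. 179)] -/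
theorem cechOpen_image_le_apply {n : ℕ} (α : Fin (n + 1) → ι) (k : Fin (n + 1)) :
    cechOpen U (Finset.univ.image α) ≤ U (α k) :=
  cechOpen_le U (Finset.mem_image_of_mem α (Finset.mem_univ k))

/-- `V ≤ U_{ {α} }` as soon as `V ≤ U_{α k}` for every position `k`. [cite: GortzWedhorn2023, Def. 21.64 (p. 179)] -/
theorem le_cechOpen_image_of_forall {n : ℕ} (α : Fin (n + 1) → ι) {V : X.Opens} (h : ∀ k, V ≤ U (α k)) :
    V ≤ cechOpen U (Finset.univ.image α) := by
  refine Finset.le_inf fun i hi => ?_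
  obtain ⟨k, -, rfl⟩ := Finset.mem_image.1 hi
  exact h k

/-- `U_j ∩ U_l ≤ U_{ {j,l} }`. [cite: GortzWedhorn2023, Def. 21.64 (p. 179)] -/
theorem inf_le_cechOpen_pair (j l : ι) : U j ⊓ U l ≤ cechOpen U (Finset.univ.image ![j, l]) :=
  le_cechOpen_image_of_forall U _ fun k => by fin_cases k <;> simp

/-- `U_j ∩ U_l ∩ U_m ≤ U_{ {j,l,m} }`. [cite: GortzWedhorn2023, Def. 21.64 (p. 179)] -/
theorem inf_le_cechOpen_triple (j l m : ι) : U j ⊓ U l ⊓ U m ≤ cechOpen U (Finset.univ.image ![j, l, m]) :=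
  le_cechOpen_image_of_forall U _ fun k => by
    fin_cases k
    · exact inf_le_left.trans inf_le_left
    · exact inf_le_left.trans inf_le_right
    · exact inf_le_right

/-- `U_{ {α} } ≤ U_{α 0} ∩ U_{α 1} ∩ U_{α 2}` for a `2`-tuple. [cite: GortzWedhorn2023, Def. 21.64 (p. 179)] -/
theorem cechOpen_image_le_inf₃ (α : Fin 3 → ι) : cechOpen U (Finset.univ.image α) ≤ U (α 0) ⊓ U (α 1) ⊓ U (α 2) :=
  le_inf (le_inf (cechOpen_image_le_apply U α 0) (cechOpen_image_le_apply U α 1)) (cechOpen_image_le_apply U α 2)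

omit [LinearOrder ι] in
/-- Front face of `(j,l,m)` is `(j,l)`. [cite: StacksProject, Tag 01FP] -/
private theorem front_triple (j l m : ι) : Full.front 1 1 2 rfl (![j, l, m] : Fin 3 → ι) = (![j, l] : Fin 2 → ι) := by
  funext k; fin_cases k <;> rfl

omit [LinearOrder ι] in
/-- Back face of `(j,l,m)` is `(l,m)`. [cite: StacksProject, Tag 01FP] -/
private theorem back_triple (j l m : ι) : Full.back 1 1 2 rfl (![j, l, m] : Fin 3 → ι) = (![l, m] : Fin 2 → ι) := by
  funext k; fin_cases k <;> rfl

omit [LinearOrder ι] in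
/-- The faces of `(j,l,m)`. [cite: StacksProject, Tag 01FG] -/
private theorem face_triple₀ (j l m : ι) : ((![j, l, m] : Fin 3 → ι) ∘ (Fin.succAbove (0 : Fin 3) : Fin 2 → Fin 3)) = (![l, m] : Fin 2 → ι) := by
  funext k; fin_cases k <;> rfl

omit [LinearOrder ι] in
/-- The faces of `(j,l,m)`. [cite: StacksProject, Tag 01FG] -/
private theorem face_triple₁ (j l m : ι) : ((![j, l, m] : Fin 3 → ι) ∘ (Fin.succAbove (1 : Fin 3) : Fin 2 → Fin 3)) = (![j, m] : Fin 2 → ι) := by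
  funext k; fin_cases k <;> rfl

omit [LinearOrder ι] in
/-- The faces of `(j,l,m)`. [cite: StacksProject, Tag 01FG] -/
private theorem face_triple₂ (j l m : ι) : ((![j, l, m] : Fin 3 → ι) ∘ (Fin.succAbove (2 : Fin 3) : Fin 2 → Fin 3)) = (![j, l] : Fin 2 → ι) := by
  funext k; fin_cases k <;> rfl

omit [LinearOrder ι] in
/-- `toRing` as an additive map: it commutes with negation. [cite: GortzWedhorn2023, Def. 21.68 (p. 180)] -/
theorem SecMod.toRing_neg {V : X.Opens} (x : SecMod (unitModule X) ρ V) : SecMod.toRing ρ (-x) = -SecMod.toRing ρ x :=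
  map_neg (⟨⟨SecMod.toRing ρ, SecMod.toRing_zero ρ⟩, SecMod.toRing_add ρ⟩ : SecMod (unitModule X) ρ V →+ Γ(X, V)) x

omit [LinearOrder ι] in
/-- `toRing` commutes with subtraction. [cite: GortzWedhorn2023, Def. 21.68 (p. 180)] -/
theorem SecMod.toRing_sub {V : X.Opens} (x y : SecMod (unitModule X) ρ V) :
    SecMod.toRing ρ (x - y) = SecMod.toRing ρ x - SecMod.toRing ρ y :=
  map_sub (⟨⟨SecMod.toRing ρ, SecMod.toRing_zero ρ⟩, SecMod.toRing_add ρ⟩ : SecMod (unitModule X) ρ V →+ Γ(X, V)) x y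

omit [LinearOrder ι] in
/-- `toRing` commutes with finite sums. [cite: GortzWedhorn2023, Def. 21.68 (p. 180)] -/
theorem SecMod.toRing_sum {V : X.Opens} {κ : Type*} (t : Finset κ) (f : κ → SecMod (unitModule X) ρ V) :
    SecMod.toRing ρ (∑ i ∈ t, f i) = ∑ i ∈ t, SecMod.toRing ρ (f i) :=
  map_sum (⟨⟨SecMod.toRing ρ, SecMod.toRing_zero ρ⟩, SecMod.toRing_add ρ⟩ : SecMod (unitModule X) ρ V →+ Γ(X, V)) f t

/-- Composite restrictions of functions (plumbing). [folklore] -/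
private theorem resFun_resFun {U₁ U₂ U₃ : X.Opens} (h₁ : U₂ ≤ U₁) (h₂ : U₃ ≤ U₂) (x : Γ(X, U₁)) :
    X.presheaf.map (homOfLE h₂).op (X.presheaf.map (homOfLE h₁).op x) = X.presheaf.map (homOfLE (h₂.trans h₁)).op x := by
  rw [← CommRingCat.comp_apply, ← Functor.map_comp]
  rfl

/-- Restriction along `V ≤ W ≤ V` is the identity (plumbing). [folklore] -/
private theorem resFun_resFun_self {V W : X.Opens} (h₁ : W ≤ V) (h₂ : V ≤ W) (x : Γ(X, V)) :
    X.presheaf.map (homOfLE h₂).op (X.presheaf.map (homOfLE h₁).op x) = x := by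
  rw [resFun_resFun h₁ h₂]
  have : homOfLE (h₂.trans h₁ : V ≤ V) = 𝟙 V := rfl
  rw [this, op_id, X.presheaf.map_id]
  rfl

/-! ## §1 Read-outs of the full side in raw letters -/

omit [LinearOrder ι] in
/-- **The maps of the system of sections are restrictions of functions**: `toRing (S.map h x) = (toRing x)|`.
[cite: GortzWedhorn2023, Def. 21.68 (p. 180)] -/
theorem toRing_sectionsSystem_map {s t : Finset ι} (h : s ⊆ t) (x : (sectionsSystem U (unitModule X) ρ).obj s) :
    SecMod.toRing ρ (((sectionsSystem U (unitModule X) ρ).map (homOfLE h)).hom x) =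
      X.presheaf.map (homOfLE (cechOpen_anti U h)).op (SecMod.toRing ρ x) := by
  rw [sectionsSystem_map_apply]
  rfl

omit [LinearOrder ι] in
/-- Reading a restricted component below: `(toRing (S.map h x))|_V = (toRing x)|_V`. [cite: GortzWedhorn2023, Def. 21.68 (p. 180)] -/
theorem map_toRing_sectionsSystem_map {s t : Finset ι} (h : s ⊆ t) (x : (sectionsSystem U (unitModule X) ρ).obj s)
    {V : X.Opens} (hV : V ≤ cechOpen U t) :
    X.presheaf.map (homOfLE hV).op (SecMod.toRing ρ (((sectionsSystem U (unitModule X) ρ).map (homOfLE h)).hom x)) =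
      X.presheaf.map (homOfLE (hV.trans (cechOpen_anti U h))).op (SecMod.toRing ρ x) := by
  rw [toRing_sectionsSystem_map, resFun_resFun]

/-- Reading a full cochain at equal tuples gives the same function. [cite: StacksProject, Tag 01FG] -/
theorem map_toRing_apply_congr {n : ℕ} (c : Full.Cochain (sectionsSystem U (unitModule X) ρ) n)
    {α α' : Fin (n + 1) → ι} (h : α = α') {V : X.Opens} (hV : V ≤ cechOpen U (Finset.univ.image α))
    (hV' : V ≤ cechOpen U (Finset.univ.image α')) :
    X.presheaf.map (homOfLE hV).op (SecMod.toRing ρ (c α)) = X.presheaf.map (homOfLE hV').op (SecMod.toRing ρ (c α')) := by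
  subst h
  rfl

/-- **The cup product of two full `1`-cochains of `𝒪_X` at `(j,l,m)`, read on `V ≤ U_j ∩ U_l ∩ U_m`, is `x_{jl}|_V · y_{lm}|_V`.**
[cite: StacksProject, Tag 01FP] [cite: GortzWedhorn2023, Def. 21.68 (p. 180)] -/
theorem map_toRing_cup_one_one (x y : Full.Cochain (sectionsSystem U (unitModule X) ρ) 1) (j l m : ι) {V : X.Opens}
    (hV : V ≤ cechOpen U (Finset.univ.image ![j, l, m])) (hjl : V ≤ cechOpen U (Finset.univ.image ![j, l]))
    (hlm : V ≤ cechOpen U (Finset.univ.image ![l, m])) :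
    X.presheaf.map (homOfLE hV).op (SecMod.toRing ρ (Full.cup (mulPairing U ρ) 1 1 2 rfl x y ![j, l, m])) =
      X.presheaf.map (homOfLE hjl).op (SecMod.toRing ρ (x ![j, l])) *
        X.presheaf.map (homOfLE hlm).op (SecMod.toRing ρ (y ![l, m])) := by
  have c₁ := map_toRing_apply_congr U ρ x (front_triple j l m) ((front_triple j l m).symm ▸ hjl) hjl
  have c₂ := map_toRing_apply_congr U ρ y (back_triple j l m) ((back_triple j l m).symm ▸ hlm) hlm
  rw [Full.cup_apply, toRing_mulPairing, map_mul, map_toRing_sectionsSystem_map, map_toRing_sectionsSystem_map]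
  simp only [c₁, c₂]

/-- **The differential `Full 1 → Full 2` of `𝒪_X` at `(j,l,m)`, read on `V ≤ U_j ∩ U_l ∩ U_m`, is `w_{lm}| − w_{jm}| + w_{jl}|`.**
[cite: StacksProject, Tag 01FG] [cite: GortzWedhorn2023, Def. 21.64 (p. 179)] -/
theorem map_toRing_d_one (w : Full.Cochain (sectionsSystem U (unitModule X) ρ) 1) (j l m : ι) {V : X.Opens}
    (hV : V ≤ cechOpen U (Finset.univ.image ![j, l, m])) (hlm : V ≤ cechOpen U (Finset.univ.image ![l, m]))
    (hjm : V ≤ cechOpen U (Finset.univ.image ![j, m])) (hjl : V ≤ cechOpen U (Finset.univ.image ![j, l])) :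
    X.presheaf.map (homOfLE hV).op
        (SecMod.toRing ρ (((Full.complex (sectionsSystem U (unitModule X) ρ)).d 1 2).hom w ![j, l, m])) =
      X.presheaf.map (homOfLE hlm).op (SecMod.toRing ρ (w ![l, m])) -
        X.presheaf.map (homOfLE hjm).op (SecMod.toRing ρ (w ![j, m])) +
        X.presheaf.map (homOfLE hjl).op (SecMod.toRing ρ (w ![j, l])) := by
  have e0 : ((-1 : ℤ) ^ ((0 : Fin 3) : ℕ)) = 1 := by decide
  have e1 : ((-1 : ℤ) ^ ((1 : Fin 3) : ℕ)) = -1 := by decide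
  have e2 : ((-1 : ℤ) ^ ((2 : Fin 3) : ℕ)) = 1 := by decide
  have c₀ := map_toRing_apply_congr U ρ w (face_triple₀ j l m) ((face_triple₀ j l m).symm ▸ hlm) hlm
  have c₁ := map_toRing_apply_congr U ρ w (face_triple₁ j l m) ((face_triple₁ j l m).symm ▸ hjm) hjm
  have c₂ := map_toRing_apply_congr U ρ w (face_triple₂ j l m) ((face_triple₂ j l m).symm ▸ hjl) hjl
  rw [Full.complex_d_apply, Fin.sum_univ_three, e0, e1, e2, one_zsmul, one_zsmul, neg_one_zsmul, SecMod.toRing_add,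
    SecMod.toRing_add, SecMod.toRing_neg, map_add, map_add, map_neg, map_toRing_sectionsSystem_map,
    map_toRing_sectionsSystem_map, map_toRing_sectionsSystem_map]
  simp only [c₀, c₁, c₂]
  abel

/-- **The differential `Full 2 → Full 3` of `𝒪_X` at a `3`-tuple `β`, read on `V ≤ U_{ {β} }`, is the alternating sum of the
faces `c(β ∘ δ_k)|_V`** (faces kept as compositions `β ∘ Fin.succAbove k`). [cite: StacksProject, Tag 01FG]
[cite: GortzWedhorn2023, Def. 21.64 (p. 179)] -/
theorem map_toRing_d_two (c : Full.Cochain (sectionsSystem U (unitModule X) ρ) 2) (β : Fin (3 + 1) → ι) {V : X.Opens}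
    (hV : V ≤ cechOpen U (Finset.univ.image β))
    (h₀ : V ≤ cechOpen U (Finset.univ.image (β ∘ Fin.succAbove (0 : Fin (3 + 1)))))
    (h₁ : V ≤ cechOpen U (Finset.univ.image (β ∘ Fin.succAbove (1 : Fin (3 + 1)))))
    (h₂ : V ≤ cechOpen U (Finset.univ.image (β ∘ Fin.succAbove (2 : Fin (3 + 1)))))
    (h₃ : V ≤ cechOpen U (Finset.univ.image (β ∘ Fin.succAbove (3 : Fin (3 + 1))))) :
    X.presheaf.map (homOfLE hV).op
        (SecMod.toRing ρ (((Full.complex (sectionsSystem U (unitModule X) ρ)).d 2 3).hom c β)) =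
      X.presheaf.map (homOfLE h₀).op (SecMod.toRing ρ (c (β ∘ Fin.succAbove (0 : Fin (3 + 1))))) -
        X.presheaf.map (homOfLE h₁).op (SecMod.toRing ρ (c (β ∘ Fin.succAbove (1 : Fin (3 + 1))))) +
        X.presheaf.map (homOfLE h₂).op (SecMod.toRing ρ (c (β ∘ Fin.succAbove (2 : Fin (3 + 1))))) -
        X.presheaf.map (homOfLE h₃).op (SecMod.toRing ρ (c (β ∘ Fin.succAbove (3 : Fin (3 + 1))))) := by
  have e0 : ((-1 : ℤ) ^ ((0 : Fin (3 + 1)) : ℕ)) = 1 := by decide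
  have e1 : ((-1 : ℤ) ^ ((1 : Fin (3 + 1)) : ℕ)) = -1 := by decide
  have e2 : ((-1 : ℤ) ^ ((2 : Fin (3 + 1)) : ℕ)) = 1 := by decide
  have e3 : ((-1 : ℤ) ^ ((3 : Fin (3 + 1)) : ℕ)) = -1 := by decide
  rw [Full.complex_d_apply, Fin.sum_univ_four, e0, e1, e2, e3, one_zsmul, one_zsmul, neg_one_zsmul, neg_one_zsmul,
    SecMod.toRing_add, SecMod.toRing_add, SecMod.toRing_add, SecMod.toRing_neg, SecMod.toRing_neg, map_add, map_add, map_add,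
    map_neg, map_neg, map_toRing_sectionsSystem_map, map_toRing_sectionsSystem_map, map_toRing_sectionsSystem_map,
    map_toRing_sectionsSystem_map]
  abel

/-! ## §2 A raw `2`-cocycle transported to the full complex is a cocycle -/

omit [LinearOrder ι] in
/-- Reading a raw `2`-cochain at equal indices (transport along index equalities). [folklore] -/
private theorem raw_congr₃ (s : (j l m : ι) → Γ(X, U j ⊓ U l ⊓ U m)) {j l m j' l' m' : ι} (hj : j = j') (hl : l = l')
    (hm : m = m') {V : X.Opens} (h : V ≤ U j ⊓ U l ⊓ U m) (h' : V ≤ U j' ⊓ U l' ⊓ U m') :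
    X.presheaf.map (homOfLE h).op (s j l m) = X.presheaf.map (homOfLE h').op (s j' l' m') := by
  subst hj hl hm
  rfl

/-- **A raw Čech `2`-cocycle of `𝒪_X`, transported to `Full.Cochain S 2` along `U_{ {α} } ≤ U_{α 0} ∩ U_{α 1} ∩ U_{α 2}`, is a
cocycle of the full complex.**  `c` is any full `2`-cochain reading `s` (`hc`; e.g. `c α := (s (α 0) (α 1) (α 2))|`), `hs` is the
raw cocycle identity `s_{lmn}| − s_{jmn}| + s_{jln}| − s_{jlm}| = 0` on `U_j ∩ U_l ∩ U_m ∩ U_n` (shape of ★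
`Deformation.pairObstructionCochain_cocycle`). [cite: StacksProject, Tag 01FG] [cite: GortzWedhorn2023, Def. 21.64 (p. 179)] -/
theorem full_d_eq_zero_of_raw_cocycle (s : (j l m : ι) → Γ(X, U j ⊓ U l ⊓ U m))
    (c : Full.Cochain (sectionsSystem U (unitModule X) ρ) 2)
    (hc : ∀ α : Fin (2 + 1) → ι, SecMod.toRing ρ (c α) =
      X.presheaf.map (homOfLE (cechOpen_image_le_inf₃ U α)).op (s (α 0) (α 1) (α 2)))
    (hs : ∀ j l m n : ι,
      X.presheaf.map (homOfLE (le_inf (le_inf (inf_le_left.trans (inf_le_left.trans inf_le_right))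
            (inf_le_left.trans inf_le_right)) inf_le_right :
          U j ⊓ U l ⊓ U m ⊓ U n ≤ U l ⊓ U m ⊓ U n)).op (s l m n) -
        X.presheaf.map (homOfLE (le_inf (le_inf (inf_le_left.trans (inf_le_left.trans inf_le_left))
            (inf_le_left.trans inf_le_right)) inf_le_right :
          U j ⊓ U l ⊓ U m ⊓ U n ≤ U j ⊓ U m ⊓ U n)).op (s j m n) +
        X.presheaf.map (homOfLE (le_inf (inf_le_left.trans inf_le_left) inf_le_right :
          U j ⊓ U l ⊓ U m ⊓ U n ≤ U j ⊓ U l ⊓ U n)).op (s j l n) -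
        X.presheaf.map (homOfLE (inf_le_left : U j ⊓ U l ⊓ U m ⊓ U n ≤ U j ⊓ U l ⊓ U m)).op (s j l m) = 0) :
    ((Full.complex (sectionsSystem U (unitModule X) ρ)).d 2 3).hom c = 0 := by
  refine funext fun (β : Fin (3 + 1) → ι) => ?_
  apply SecMod.toRing_injective ρ
  rw [Pi.zero_apply, SecMod.toRing_zero]
  -- restriction to `V := U_{β 0} ∩ U_{β 1} ∩ U_{β 2} ∩ U_{β 3} = U_{ {β} }` is injective
  have hVle : U (β 0) ⊓ U (β 1) ⊓ U (β 2) ⊓ U (β 3) ≤ cechOpen U (Finset.univ.image β) :=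
    le_cechOpen_image_of_forall U β fun k => by
      fin_cases k
      · exact inf_le_left.trans (inf_le_left.trans inf_le_left)
      · exact inf_le_left.trans (inf_le_left.trans inf_le_right)
      · exact inf_le_left.trans inf_le_right
      · exact inf_le_right
  have hle : cechOpen U (Finset.univ.image β) ≤ U (β 0) ⊓ U (β 1) ⊓ U (β 2) ⊓ U (β 3) :=
    le_inf (le_inf (le_inf (cechOpen_image_le_apply U β 0) (cechOpen_image_le_apply U β 1)) (cechOpen_image_le_apply U β 2))
      (cechOpen_image_le_apply U β 3)
  have key := resFun_resFun_self (X := X) hVle hle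
    (SecMod.toRing ρ (((Full.complex (sectionsSystem U (unitModule X) ρ)).d 2 3).hom c β))
  rw [← key,
    map_toRing_d_two U ρ c β hVle (hVle.trans (cechOpen_anti U (Full.image_comp_subset β _)))
      (hVle.trans (cechOpen_anti U (Full.image_comp_subset β _))) (hVle.trans (cechOpen_anti U (Full.image_comp_subset β _)))
      (hVle.trans (cechOpen_anti U (Full.image_comp_subset β _))),
    hc, hc, hc, hc, resFun_resFun, resFun_resFun, resFun_resFun, resFun_resFun]
  -- read the four faces in raw letters
  rw [raw_congr₃ U s (j := (β ∘ Fin.succAbove (0 : Fin (3 + 1))) 0) (l := (β ∘ Fin.succAbove (0 : Fin (3 + 1))) 1)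
      (m := (β ∘ Fin.succAbove (0 : Fin (3 + 1))) 2) (congrArg β (by decide)) (congrArg β (by decide)) (congrArg β (by decide))
      _ (le_inf (le_inf (inf_le_left.trans (inf_le_left.trans inf_le_right)) (inf_le_left.trans inf_le_right)) inf_le_right :
        U (β 0) ⊓ U (β 1) ⊓ U (β 2) ⊓ U (β 3) ≤ U (β 1) ⊓ U (β 2) ⊓ U (β 3)),
    raw_congr₃ U s (j := (β ∘ Fin.succAbove (1 : Fin (3 + 1))) 0) (l := (β ∘ Fin.succAbove (1 : Fin (3 + 1))) 1)
      (m := (β ∘ Fin.succAbove (1 : Fin (3 + 1))) 2) (congrArg β (by decide)) (congrArg β (by decide)) (congrArg β (by decide))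
      _ (le_inf (le_inf (inf_le_left.trans (inf_le_left.trans inf_le_left)) (inf_le_left.trans inf_le_right)) inf_le_right :
        U (β 0) ⊓ U (β 1) ⊓ U (β 2) ⊓ U (β 3) ≤ U (β 0) ⊓ U (β 2) ⊓ U (β 3)),
    raw_congr₃ U s (j := (β ∘ Fin.succAbove (2 : Fin (3 + 1))) 0) (l := (β ∘ Fin.succAbove (2 : Fin (3 + 1))) 1)
      (m := (β ∘ Fin.succAbove (2 : Fin (3 + 1))) 2) (congrArg β (by decide)) (congrArg β (by decide)) (congrArg β (by decide))
      _ (le_inf (inf_le_left.trans inf_le_left) inf_le_right : U (β 0) ⊓ U (β 1) ⊓ U (β 2) ⊓ U (β 3) ≤ U (β 0) ⊓ U (β 1) ⊓ U (β 3)),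
    raw_congr₃ U s (j := (β ∘ Fin.succAbove (3 : Fin (3 + 1))) 0) (l := (β ∘ Fin.succAbove (3 : Fin (3 + 1))) 1)
      (m := (β ∘ Fin.succAbove (3 : Fin (3 + 1))) 2) (congrArg β (by decide)) (congrArg β (by decide)) (congrArg β (by decide))
      _ (inf_le_left : U (β 0) ⊓ U (β 1) ⊓ U (β 2) ⊓ U (β 3) ≤ U (β 0) ⊓ U (β 1) ⊓ U (β 2)),
    hs (β 0) (β 1) (β 2) (β 3), map_zero]

/-! ## §3 Reading full `1`-cocycles and the decomposition `d w = c − ∑ aᵢ ∪ bᵢ` in raw letters -/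

/-- **A full `1`-cocycle of `𝒪_X`, read in raw letters `a′_{jl} := a(j,l)|_{U_j ∩ U_l}`, satisfies the raw cocycle identity
`a′_{jl}| + a′_{lm}| = a′_{jm}|` on `U_j ∩ U_l ∩ U_m`** (shape of ★ `Morphisms.cechD1` ∕ the `ha hc` binders of ★
`AbelianSchemeOver.exists_tangentCocycle_of_sum_cup`). [cite: StacksProject, Tag 01FG] [cite: GortzWedhorn2023, Def. 21.64 (p. 179)] -/
theorem raw_cocycle_of_full_d_eq_zero (a : Full.Cochain (sectionsSystem U (unitModule X) ρ) 1)
    (ha : ((Full.complex (sectionsSystem U (unitModule X) ρ)).d 1 2).hom a = 0) (j l m : ι) :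
    X.presheaf.map (homOfLE (inf_le_left : U j ⊓ U l ⊓ U m ≤ U j ⊓ U l)).op
        (X.presheaf.map (homOfLE (inf_le_cechOpen_pair U j l)).op (SecMod.toRing ρ (a ![j, l]))) +
      X.presheaf.map (homOfLE (le_inf (inf_le_left.trans inf_le_right) inf_le_right : U j ⊓ U l ⊓ U m ≤ U l ⊓ U m)).op
        (X.presheaf.map (homOfLE (inf_le_cechOpen_pair U l m)).op (SecMod.toRing ρ (a ![l, m]))) =
      X.presheaf.map (homOfLE (le_inf (inf_le_left.trans inf_le_left) inf_le_right : U j ⊓ U l ⊓ U m ≤ U j ⊓ U m)).op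
        (X.presheaf.map (homOfLE (inf_le_cechOpen_pair U j m)).op (SecMod.toRing ρ (a ![j, m]))) := by
  have h := map_toRing_d_one U ρ a j l m (inf_le_cechOpen_triple U j l m)
    ((le_inf (inf_le_left.trans inf_le_right) inf_le_right : U j ⊓ U l ⊓ U m ≤ U l ⊓ U m).trans (inf_le_cechOpen_pair U l m))
    ((le_inf (inf_le_left.trans inf_le_left) inf_le_right : U j ⊓ U l ⊓ U m ≤ U j ⊓ U m).trans (inf_le_cechOpen_pair U j m))
    ((inf_le_left : U j ⊓ U l ⊓ U m ≤ U j ⊓ U l).trans (inf_le_cechOpen_pair U j l))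
  rw [ha, Pi.zero_apply, SecMod.toRing_zero, map_zero] at h
  rw [resFun_resFun, resFun_resFun, resFun_resFun]
  linear_combination -h

/-- **The decomposition `d w = c − ∑ᵢ aᵢ ∪ bᵢ` of the full complex read at `(j,l,m)`**: if `c` reads the raw `2`-cochain `s`
(`hc`), then on `U_j ∩ U_l ∩ U_m`
`s_{jlm} = ∑ᵢ aᵢ(j,l)| · bᵢ(l,m)| + (h′_{jm}| − h′_{jl}| − h′_{lm}|)` with `h′_{jl} := −w(j,l)|_{U_j ∩ U_l}` — the `hJ3` letter of ★
`AbelianSchemeOver.exists_tangentCocycle_of_sum_cup`. [cite: StacksProject, Tag 01FP] [cite: GortzWedhorn2023, Def. 21.68 (p. 180)] -/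
theorem raw_eq_sum_cup_add_of_full (s : (j l m : ι) → Γ(X, U j ⊓ U l ⊓ U m))
    (c : Full.Cochain (sectionsSystem U (unitModule X) ρ) 2)
    (hc : ∀ α : Fin (2 + 1) → ι, SecMod.toRing ρ (c α) =
      X.presheaf.map (homOfLE (cechOpen_image_le_inf₃ U α)).op (s (α 0) (α 1) (α 2)))
    {σ : Type} [Fintype σ] (a b : σ → Full.Cochain (sectionsSystem U (unitModule X) ρ) 1)
    (w : Full.Cochain (sectionsSystem U (unitModule X) ρ) 1)
    (hw : ((Full.complex (sectionsSystem U (unitModule X) ρ)).d 1 2).hom w =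
      c - ∑ i, Full.cup (mulPairing U ρ) 1 1 2 rfl (a i) (b i)) (j l m : ι) :
    s j l m =
      ∑ i, X.presheaf.map (homOfLE (inf_le_left : U j ⊓ U l ⊓ U m ≤ U j ⊓ U l)).op
            (X.presheaf.map (homOfLE (inf_le_cechOpen_pair U j l)).op (SecMod.toRing ρ (a i ![j, l]))) *
          X.presheaf.map (homOfLE (le_inf (inf_le_left.trans inf_le_right) inf_le_right :
            U j ⊓ U l ⊓ U m ≤ U l ⊓ U m)).op
            (X.presheaf.map (homOfLE (inf_le_cechOpen_pair U l m)).op (SecMod.toRing ρ (b i ![l, m]))) +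
      (X.presheaf.map (homOfLE (le_inf (inf_le_left.trans inf_le_left) inf_le_right :
            U j ⊓ U l ⊓ U m ≤ U j ⊓ U m)).op
            (-X.presheaf.map (homOfLE (inf_le_cechOpen_pair U j m)).op (SecMod.toRing ρ (w ![j, m]))) -
          X.presheaf.map (homOfLE (inf_le_left : U j ⊓ U l ⊓ U m ≤ U j ⊓ U l)).op
            (-X.presheaf.map (homOfLE (inf_le_cechOpen_pair U j l)).op (SecMod.toRing ρ (w ![j, l]))) -
          X.presheaf.map (homOfLE (le_inf (inf_le_left.trans inf_le_right) inf_le_right :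
            U j ⊓ U l ⊓ U m ≤ U l ⊓ U m)).op
            (-X.presheaf.map (homOfLE (inf_le_cechOpen_pair U l m)).op (SecMod.toRing ρ (w ![l, m])))) := by
  have h := map_toRing_d_one U ρ w j l m (inf_le_cechOpen_triple U j l m)
    ((le_inf (inf_le_left.trans inf_le_right) inf_le_right : U j ⊓ U l ⊓ U m ≤ U l ⊓ U m).trans (inf_le_cechOpen_pair U l m))
    ((le_inf (inf_le_left.trans inf_le_left) inf_le_right : U j ⊓ U l ⊓ U m ≤ U j ⊓ U m).trans (inf_le_cechOpen_pair U j m))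
    ((inf_le_left : U j ⊓ U l ⊓ U m ≤ U j ⊓ U l).trans (inf_le_cechOpen_pair U j l))
  rw [hw, Pi.sub_apply, Finset.sum_apply, SecMod.toRing_sub, SecMod.toRing_sum, map_sub, map_sum, hc] at h
  have r : X.presheaf.map (homOfLE (inf_le_cechOpen_triple U j l m)).op
      (X.presheaf.map (homOfLE (cechOpen_image_le_inf₃ U ![j, l, m])).op (s (![j, l, m] 0) (![j, l, m] 1) (![j, l, m] 2))) =
      s j l m :=
    resFun_resFun_self (X := X) _ _ (s j l m)
  have hcup : ∀ i, X.presheaf.map (homOfLE (inf_le_cechOpen_triple U j l m)).op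
      (SecMod.toRing ρ (Full.cup (mulPairing U ρ) 1 1 2 rfl (a i) (b i) ![j, l, m])) =
      X.presheaf.map (homOfLE ((inf_le_left : U j ⊓ U l ⊓ U m ≤ U j ⊓ U l).trans (inf_le_cechOpen_pair U j l))).op
          (SecMod.toRing ρ (a i ![j, l])) *
        X.presheaf.map (homOfLE ((le_inf (inf_le_left.trans inf_le_right) inf_le_right :
          U j ⊓ U l ⊓ U m ≤ U l ⊓ U m).trans (inf_le_cechOpen_pair U l m))).op (SecMod.toRing ρ (b i ![l, m])) :=
    fun i => map_toRing_cup_one_one U ρ (a i) (b i) j l m _ _ _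
  rw [r] at h
  simp only [hcup] at h
  rw [map_neg, map_neg, map_neg, resFun_resFun, resFun_resFun, resFun_resFun]
  simp only [resFun_resFun]
  linear_combination h

/-! ## §4 HEAD — raw `2`-cocycles are sums of raw cups of `1`-cocycles plus a coboundary, given F-J3b HEAD 2 -/

/-- **HEAD.**  IF every cocycle of the full algebraic Čech complex of `𝒪_X` on `𝓤` in degree `2` is a finite sum of cup products
of full `1`-cocycles plus a coboundary (the letter of F-J3b HEAD 2 `FJ3b.exists_sum_cup_add_d_of_surjective`, as a hypothesis),
THEN every RAW Čech `2`-cocycle `s` (cocycle identity `hs` of ★ `Deformation.pairObstructionCochain_cocycle`'s shape) is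
`s_{jlm} = ∑ᵢ aᵢ_{jl}| · cᵢ_{lm}| + (h′_{jm}| − h′_{jl}| − h′_{lm}|)` for raw `1`-cocycles `aᵢ cᵢ` and a raw `1`-cochain `h′` — the
`σ a c ha hc h' hJ3` block of ★ `AbelianSchemeOver.exists_tangentCocycle_of_sum_cup` VERBATIM (there with `U j := (U j).1`).
[cite: StacksProject, Tag 01FP] [cite: GortzWedhorn2023, Def. 21.68 (p. 180)] -/
theorem exists_raw_sum_cup_of_full (s : (j l m : ι) → Γ(X, U j ⊓ U l ⊓ U m))
    (hs : ∀ j l m n : ι,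
      X.presheaf.map (homOfLE (le_inf (le_inf (inf_le_left.trans (inf_le_left.trans inf_le_right))
            (inf_le_left.trans inf_le_right)) inf_le_right :
          U j ⊓ U l ⊓ U m ⊓ U n ≤ U l ⊓ U m ⊓ U n)).op (s l m n) -
        X.presheaf.map (homOfLE (le_inf (le_inf (inf_le_left.trans (inf_le_left.trans inf_le_left))
            (inf_le_left.trans inf_le_right)) inf_le_right :
          U j ⊓ U l ⊓ U m ⊓ U n ≤ U j ⊓ U m ⊓ U n)).op (s j m n) +
        X.presheaf.map (homOfLE (le_inf (inf_le_left.trans inf_le_left) inf_le_right :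
          U j ⊓ U l ⊓ U m ⊓ U n ≤ U j ⊓ U l ⊓ U n)).op (s j l n) -
        X.presheaf.map (homOfLE (inf_le_left : U j ⊓ U l ⊓ U m ⊓ U n ≤ U j ⊓ U l ⊓ U m)).op (s j l m) = 0)
    (hfull : ∀ c : Full.Cochain (sectionsSystem U (unitModule X) ρ) 2,
      ((Full.complex (sectionsSystem U (unitModule X) ρ)).d 2 3).hom c = 0 →
        ∃ (σ : Type) (_ : Fintype σ) (a b : σ → Full.Cochain (sectionsSystem U (unitModule X) ρ) 1)
          (_ : ∀ i, ((Full.complex (sectionsSystem U (unitModule X) ρ)).d 1 2).hom (a i) = 0)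
          (_ : ∀ i, ((Full.complex (sectionsSystem U (unitModule X) ρ)).d 1 2).hom (b i) = 0)
          (w : Full.Cochain (sectionsSystem U (unitModule X) ρ) 1),
          ((Full.complex (sectionsSystem U (unitModule X) ρ)).d 1 2).hom w =
            c - ∑ i, Full.cup (mulPairing U ρ) 1 1 2 rfl (a i) (b i)) :
    ∃ (σ : Type) (_ : Fintype σ) (a c : σ → (j l : ι) → Γ(X, U j ⊓ U l))
      (_ : ∀ (i : σ) (j l m : ι),
        X.presheaf.map (homOfLE (inf_le_left : U j ⊓ U l ⊓ U m ≤ U j ⊓ U l)).op (a i j l) +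
            X.presheaf.map (homOfLE (le_inf (inf_le_left.trans inf_le_right) inf_le_right :
              U j ⊓ U l ⊓ U m ≤ U l ⊓ U m)).op (a i l m) =
          X.presheaf.map (homOfLE (le_inf (inf_le_left.trans inf_le_left) inf_le_right :
            U j ⊓ U l ⊓ U m ≤ U j ⊓ U m)).op (a i j m))
      (_ : ∀ (i : σ) (j l m : ι),
        X.presheaf.map (homOfLE (inf_le_left : U j ⊓ U l ⊓ U m ≤ U j ⊓ U l)).op (c i j l) +
            X.presheaf.map (homOfLE (le_inf (inf_le_left.trans inf_le_right) inf_le_right :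
              U j ⊓ U l ⊓ U m ≤ U l ⊓ U m)).op (c i l m) =
          X.presheaf.map (homOfLE (le_inf (inf_le_left.trans inf_le_left) inf_le_right :
            U j ⊓ U l ⊓ U m ≤ U j ⊓ U m)).op (c i j m))
      (h' : (j l : ι) → Γ(X, U j ⊓ U l)),
      ∀ j l m : ι, s j l m =
        ∑ i, X.presheaf.map (homOfLE (inf_le_left : U j ⊓ U l ⊓ U m ≤ U j ⊓ U l)).op (a i j l) *
            X.presheaf.map (homOfLE (le_inf (inf_le_left.trans inf_le_right) inf_le_right :
              U j ⊓ U l ⊓ U m ≤ U l ⊓ U m)).op (c i l m) +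
        (X.presheaf.map (homOfLE (le_inf (inf_le_left.trans inf_le_left) inf_le_right :
              U j ⊓ U l ⊓ U m ≤ U j ⊓ U m)).op (h' j m) -
            X.presheaf.map (homOfLE (inf_le_left : U j ⊓ U l ⊓ U m ≤ U j ⊓ U l)).op (h' j l) -
            X.presheaf.map (homOfLE (le_inf (inf_le_left.trans inf_le_right) inf_le_right :
              U j ⊓ U l ⊓ U m ≤ U l ⊓ U m)).op (h' l m)) := by
  obtain ⟨σ, _, a, b, ha, hb, w, hw⟩ := hfull
    (fun α => SecMod.ofRing ρ (X.presheaf.map (homOfLE (cechOpen_image_le_inf₃ U α)).op (s (α 0) (α 1) (α 2))))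
    (full_d_eq_zero_of_raw_cocycle U ρ s _ (fun _ => rfl) hs)
  exact ⟨σ, inferInstance,
    fun i j l => X.presheaf.map (homOfLE (inf_le_cechOpen_pair U j l)).op (SecMod.toRing ρ (a i ![j, l])),
    fun i j l => X.presheaf.map (homOfLE (inf_le_cechOpen_pair U j l)).op (SecMod.toRing ρ (b i ![j, l])),
    fun i j l m => raw_cocycle_of_full_d_eq_zero U ρ (a i) (ha i) j l m,
    fun i j l m => raw_cocycle_of_full_d_eq_zero U ρ (b i) (hb i) j l m,
    fun j l => -X.presheaf.map (homOfLE (inf_le_cechOpen_pair U j l)).op (SecMod.toRing ρ (w ![j, l])),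
    fun j l m => raw_eq_sum_cup_add_of_full U ρ s _ (fun _ => rfl) a b w hw j l m⟩

end Literature.AlgebraicGeometry.Modules

end
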